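import Literature.Topology.PlaneTopology.PlusCrossing
import HarnessLib

/-!
# The gate lemma: a continuum reaching a boundary point between the two feet of another
# continuum meets it

Topic: Topology / PlaneTopology.  One more planar crossing lemma for the continuum form of
Russo–Seymour–Welsh gluing arguments (V. Tassion, *Crossing probabilities for Voronoi percolation*,
Ann. Probab. 44 (2016), §§2–3: paths of a square landing in a prescribed SEGMENT of its right side
are glued to paths whose two end-segments on that side lie below and above it — Fig. 3, Fig. 5,
proof of Lemma 3.2), complementing `RectangleDuality.lean`, `StripCrossings.lean` and
`PlusCrossing.lean`:

* `inter_nonempty_of_gate_right` — **the gate lemma (gate on the right side).**  Let `K, L` be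
  compact connected subsets of the rectangle `R = [a, b] × [c, d]`.  Suppose `L` contains two
  points `q₁, q₂` of the right side `re = b` and `K` contains a point `p` of the right side with
  `im q₁ ≤ im p ≤ im q₂`, and `K` meets the left side `re = a`.  Then `K ∩ L ≠ ∅`.
  Proof: extend `K` by the horizontal unit segment to the right of `p`, and `L` by the bracket
  `{b + ½} × [c - 1, im q₁] ∪ [q₁, q₁ + ½] ∪ [q₂, q₂ + ½] ∪ {b + ½} × [im q₂, d + 1]`; the
  extensions cross the rectangle `[a, b + 1] × [c - 1, d + 1]` horizontally, resp. vertically,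
  hence meet (`inter_nonempty_of_crossing_continua`), and every common point of the extensions is
  (or produces) a common point of `K` and `L`.
* `inter_nonempty_of_gate_left` — the mirror image (gate on the left side, `K` meets the right
  side), by the reflection `z ↦ -conj z`.

Everything is proved; no named fact.

## References

* V. Tassion, Ann. Probab. 44 (2016) 3385–3398, §§2–3. [Tassion2016]
* M. H. A. Newman, *Elements of the topology of plane sets of points* (1939), Ch. V §11. [Newman1939]
-/

noncomputable section

namespace Literature.Topology.PlaneTopology

open Complex Set Metric

variable {a b c d : ℝ}

/-- **The gate lemma (gate on the right side).**  `K, L ⊆ [a, b] × [c, d]` compact connected;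
`L` contains points `q₁, q₂` of the right side, `K` contains a point `p` of the right side at a
height between those of `q₁` and `q₂`, and `K` meets the left side.  Then `K` meets `L`.
[cite: Tassion2016, §2 (Fig. 3, Fig. 5) and proof of Lemma 3.2] -/
theorem inter_nonempty_of_gate_right {K L : Set ℂ} {y : ℝ} (hab : a ≤ b) (hcd : c ≤ d)
    (hK : IsCompact K) (hKc : IsPreconnected K) (hKsub : K ⊆ Icc a b ×ℂ Icc c d)
    (hKa : ∃ z ∈ K, z.re = a) (hKp : ∃ z ∈ K, z.re = b ∧ z.im = y)
    (hL : IsCompact L) (hLc : IsPreconnected L) (hLsub : L ⊆ Icc a b ×ℂ Icc c d)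
    (hLlo : ∃ z ∈ L, z.re = b ∧ z.im ≤ y) (hLhi : ∃ z ∈ L, z.re = b ∧ y ≤ z.im) :
    (K ∩ L).Nonempty := by
  obtain ⟨p, hpK, hpre, hpim⟩ := hKp
  obtain ⟨q₁, hq₁L, hq₁re, hq₁im⟩ := hLlo
  obtain ⟨q₂, hq₂L, hq₂re, hq₂im⟩ := hLhi
  have hpR := mem_reProdIm.1 (hKsub hpK)
  have hq₁R := mem_reProdIm.1 (hLsub hq₁L)
  have hq₂R := mem_reProdIm.1 (hLsub hq₂L)
  simp only [mem_Icc] at hpR hq₁R hq₂R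
  -- the extensions
  set P : Set ℂ := Icc b (b + 1) ×ℂ Icc y y with hP
  set V₁ : Set ℂ := Icc (b + 1 / 2) (b + 1 / 2) ×ℂ Icc (c - 1) q₁.im with hV₁
  set H₁ : Set ℂ := Icc b (b + 1 / 2) ×ℂ Icc q₁.im q₁.im with hH₁
  set H₂ : Set ℂ := Icc b (b + 1 / 2) ×ℂ Icc q₂.im q₂.im with hH₂
  set V₂ : Set ℂ := Icc (b + 1 / 2) (b + 1 / 2) ×ℂ Icc q₂.im (d + 1) with hV₂
  set K' : Set ℂ := K ∪ P with hK'
  set L' : Set ℂ := (((L ∪ H₁) ∪ H₂) ∪ V₁) ∪ V₂ with hL'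
  have hconv : ∀ a' b' c' d' : ℝ, IsPreconnected (Icc a' b' ×ℂ Icc c' d') := fun a' b' c' d' =>
    (convex_Icc_reProdIm_Icc a' b' c' d').isPreconnected
  have hrc : ∀ a' b' c' d' : ℝ, IsCompact (Icc a' b' ×ℂ Icc c' d') := fun a' b' c' d' =>
    Metric.isCompact_of_isClosed_isBounded (isClosed_Icc.reProdIm isClosed_Icc)
      ((isBounded_Icc a' b').reProdIm (isBounded_Icc c' d'))
  have hmem : ∀ {a' b' c' d' : ℝ} {z : ℂ}, a' ≤ z.re → z.re ≤ b' → c' ≤ z.im → z.im ≤ d' →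
      z ∈ Icc a' b' ×ℂ Icc c' d' := fun h1 h2 h3 h4 => mem_reProdIm.2 ⟨⟨h1, h2⟩, ⟨h3, h4⟩⟩
  -- special points
  have hpP : p ∈ P := hmem hpre.ge (by linarith) hpim.ge hpim.le
  have hq₁H₁ : q₁ ∈ H₁ := hmem hq₁re.ge (by linarith) le_rfl le_rfl
  have hq₂H₂ : q₂ ∈ H₂ := hmem hq₂re.ge (by linarith) le_rfl le_rfl
  set j₁ : ℂ := ⟨b + 1 / 2, q₁.im⟩ with hj₁
  set j₂ : ℂ := ⟨b + 1 / 2, q₂.im⟩ with hj₂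
  have hj₁H₁ : j₁ ∈ H₁ := hmem (by simp [hj₁]) (by simp [hj₁]) (by simp [hj₁]) (by simp [hj₁])
  have hj₁V₁ : j₁ ∈ V₁ := hmem (by simp [hj₁]) (by simp [hj₁]) (by simp [hj₁]; linarith) (by simp [hj₁])
  have hj₂H₂ : j₂ ∈ H₂ := hmem (by simp [hj₂]) (by simp [hj₂]) (by simp [hj₂]) (by simp [hj₂])
  have hj₂V₂ : j₂ ∈ V₂ := hmem (by simp [hj₂]) (by simp [hj₂]) (by simp [hj₂]) (by simp [hj₂]; linarith)
  -- `K'` is a continuum crossing `[a, b + 1] × [c - 1, d + 1]` horizontally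
  have hK'c : IsCompact K' := hK.union (hrc _ _ _ _)
  have hK'p : IsPreconnected K' := hKc.union p hpK hpP (hconv _ _ _ _)
  have hK'sub : K' ⊆ Icc a (b + 1) ×ℂ Icc (c - 1) (d + 1) := by
    rintro z (hz | hz)
    · have h := mem_reProdIm.1 (hKsub hz); simp only [mem_Icc] at h
      exact hmem h.1.1 (by linarith [h.1.2]) (by linarith [h.2.1]) (by linarith [h.2.2])
    · have h := mem_reProdIm.1 hz; simp only [mem_Icc] at h
      exact hmem (by linarith [h.1.1]) h.1.2 (by linarith [h.2.1]) (by linarith [h.2.2])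
  have hK'a : ∃ z ∈ K', z.re = a := by
    obtain ⟨z, hz, hza⟩ := hKa; exact ⟨z, Or.inl hz, hza⟩
  have hK'b : ∃ z ∈ K', z.re = b + 1 :=
    ⟨⟨b + 1, y⟩, Or.inr (hmem (by simp) (by simp) (by simp) (by simp)), rfl⟩
  -- `L'` is a continuum crossing it vertically
  have hL'c : IsCompact L' :=
    (((hL.union (hrc _ _ _ _)).union (hrc _ _ _ _)).union
      (hrc _ _ _ _)).union (hrc _ _ _ _)
  have hL'p : IsPreconnected L' := by
    refine IsPreconnected.union j₂ (Or.inl (Or.inr hj₂H₂)) hj₂V₂ ?_ (hconv _ _ _ _)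
    refine IsPreconnected.union j₁ (Or.inl (Or.inr hj₁H₁)) hj₁V₁ ?_ (hconv _ _ _ _)
    refine IsPreconnected.union q₂ (Or.inl hq₂L) hq₂H₂ ?_ (hconv _ _ _ _)
    exact IsPreconnected.union q₁ hq₁L hq₁H₁ hLc (hconv _ _ _ _)
  have hL'sub : L' ⊆ Icc a (b + 1) ×ℂ Icc (c - 1) (d + 1) := by
    rintro z ((((hz | hz) | hz) | hz) | hz)
    · have h := mem_reProdIm.1 (hLsub hz); simp only [mem_Icc] at h
      exact hmem h.1.1 (by linarith [h.1.2]) (by linarith [h.2.1]) (by linarith [h.2.2])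
    all_goals
      have h := mem_reProdIm.1 hz; simp only [mem_Icc] at h
      exact hmem (by linarith [h.1.1]) (by linarith [h.1.2]) (by linarith [h.2.1]) (by linarith [h.2.2])
  have hL'lo : ∃ z ∈ L', z.im = c - 1 :=
    ⟨⟨b + 1 / 2, c - 1⟩, Or.inl (Or.inr (hmem (by simp) (by simp) (by simp) (by simp; linarith))), rfl⟩
  have hL'hi : ∃ z ∈ L', z.im = d + 1 :=
    ⟨⟨b + 1 / 2, d + 1⟩, Or.inr (hmem (by simp) (by simp) (by simp; linarith) (by simp)), rfl⟩
  obtain ⟨w, hwK', hwL'⟩ := inter_nonempty_of_crossing_continua (by linarith) (by linarith)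
    hK'c hK'p hK'sub hK'a hK'b hL'c hL'p hL'sub hL'lo hL'hi
  -- every common point of the extensions yields a common point of `K` and `L`
  have hpq₁ : q₁.im = y → (K ∩ L).Nonempty := fun h =>
    ⟨p, hpK, by rwa [show p = q₁ from Complex.ext (by rw [hpre, hq₁re]) (by rw [hpim, h])]⟩
  have hpq₂ : q₂.im = y → (K ∩ L).Nonempty := fun h =>
    ⟨p, hpK, by rwa [show p = q₂ from Complex.ext (by rw [hpre, hq₂re]) (by rw [hpim, h])]⟩
  rcases hwK' with hwK | hwP
  · have hwR := mem_reProdIm.1 (hKsub hwK); simp only [mem_Icc] at hwR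
    rcases hwL' with (((hwL | hw) | hw) | hw) | hw
    · exact ⟨w, hwK, hwL⟩
    · have h := mem_reProdIm.1 hw; simp only [mem_Icc] at h
      have : w = q₁ := Complex.ext (by rw [hq₁re]; linarith [h.1.1, hwR.1.2]) (le_antisymm h.2.2 h.2.1)
      exact ⟨w, hwK, this ▸ hq₁L⟩
    · have h := mem_reProdIm.1 hw; simp only [mem_Icc] at h
      have : w = q₂ := Complex.ext (by rw [hq₂re]; linarith [h.1.1, hwR.1.2]) (le_antisymm h.2.2 h.2.1)
      exact ⟨w, hwK, this ▸ hq₂L⟩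
    · have h := mem_reProdIm.1 hw; simp only [mem_Icc] at h
      exfalso; linarith [h.1.1, hwR.1.2]
    · have h := mem_reProdIm.1 hw; simp only [mem_Icc] at h
      exfalso; linarith [h.1.1, hwR.1.2]
  · have hwP' := mem_reProdIm.1 hwP; simp only [mem_Icc] at hwP'
    have hwim : w.im = y := le_antisymm hwP'.2.2 hwP'.2.1
    rcases hwL' with (((hwL | hw) | hw) | hw) | hw
    · have hwR := mem_reProdIm.1 (hLsub hwL); simp only [mem_Icc] at hwR
      have : w = p := Complex.ext (by rw [hpre]; linarith [hwP'.1.1, hwR.1.2]) (by rw [hwim, hpim])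
      exact ⟨w, this ▸ hpK, hwL⟩
    · have h := mem_reProdIm.1 hw; simp only [mem_Icc] at h
      exact hpq₁ (by linarith [h.2.1, h.2.2])
    · have h := mem_reProdIm.1 hw; simp only [mem_Icc] at h
      exact hpq₂ (by linarith [h.2.1, h.2.2])
    · have h := mem_reProdIm.1 hw; simp only [mem_Icc] at h
      exact hpq₁ (by linarith [h.2.2])
    · have h := mem_reProdIm.1 hw; simp only [mem_Icc] at h
      exact hpq₂ (by linarith [h.2.1])

/-- The reflection `z ↦ -conj z` in the imaginary axis: real and imaginary parts. [folklore] -/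
theorem neg_conj_re_im (z : ℂ) : (-(starRingEnd ℂ) z).re = -z.re ∧ (-(starRingEnd ℂ) z).im = z.im := by
  simp

/-- **The gate lemma (gate on the left side).**  `K, L ⊆ [a, b] × [c, d]` compact connected;
`L` contains points `q₁, q₂` of the left side, `K` contains a point `p` of the left side at a
height between those of `q₁` and `q₂`, and `K` meets the right side.  Then `K` meets `L`.
[cite: Tassion2016, §2 (Fig. 3, Fig. 5) and proof of Lemma 3.2] -/
theorem inter_nonempty_of_gate_left {K L : Set ℂ} {y : ℝ} (hab : a ≤ b) (hcd : c ≤ d)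
    (hK : IsCompact K) (hKc : IsPreconnected K) (hKsub : K ⊆ Icc a b ×ℂ Icc c d)
    (hKb : ∃ z ∈ K, z.re = b) (hKp : ∃ z ∈ K, z.re = a ∧ z.im = y)
    (hL : IsCompact L) (hLc : IsPreconnected L) (hLsub : L ⊆ Icc a b ×ℂ Icc c d)
    (hLlo : ∃ z ∈ L, z.re = a ∧ z.im ≤ y) (hLhi : ∃ z ∈ L, z.re = a ∧ y ≤ z.im) :
    (K ∩ L).Nonempty := by
  set σ : ℂ → ℂ := fun z => -(starRingEnd ℂ) z with hσ
  have hσc : Continuous σ := (Complex.continuous_conj).neg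
  have hσre : ∀ z, (σ z).re = -z.re := fun z => by simp [hσ]
  have hσim : ∀ z, (σ z).im = z.im := fun z => by simp [hσ]
  have hσsub : ∀ {S : Set ℂ}, S ⊆ Icc a b ×ℂ Icc c d → σ '' S ⊆ Icc (-b) (-a) ×ℂ Icc c d := by
    intro S hS
    rintro _ ⟨z, hz, rfl⟩
    have h := mem_reProdIm.1 (hS hz); simp only [mem_Icc] at h
    refine mem_reProdIm.2 ⟨⟨?_, ?_⟩, ?_, ?_⟩
    · rw [hσre]; linarith [h.1.2]
    · rw [hσre]; linarith [h.1.1]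
    · rw [hσim]; exact h.2.1
    · rw [hσim]; exact h.2.2
  obtain ⟨w, ⟨k, hk, rfl⟩, ⟨l, hl, hkl⟩⟩ := inter_nonempty_of_gate_right (K := σ '' K) (L := σ '' L)
    (y := y) (neg_le_neg hab) hcd (hK.image hσc) (hKc.image _ hσc.continuousOn) (hσsub hKsub)
    (by obtain ⟨z, hz, hzb⟩ := hKb; exact ⟨σ z, mem_image_of_mem _ hz, by rw [hσre, hzb]⟩)
    (by obtain ⟨z, hz, hza, hzy⟩ := hKp
        exact ⟨σ z, mem_image_of_mem _ hz, by rw [hσre, hza], by rw [hσim, hzy]⟩)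
    (hL.image hσc) (hLc.image _ hσc.continuousOn) (hσsub hLsub)
    (by obtain ⟨z, hz, hza, hzy⟩ := hLlo
        exact ⟨σ z, mem_image_of_mem _ hz, by rw [hσre, hza], by rw [hσim]; exact hzy⟩)
    (by obtain ⟨z, hz, hza, hzy⟩ := hLhi
        exact ⟨σ z, mem_image_of_mem _ hz, by rw [hσre, hza], by rw [hσim]; exact hzy⟩)
  have hinj : Function.Injective σ := fun z z' h => by
    have := congrArg σ h
    simpa [hσ] using this
  exact ⟨k, hk, (hinj hkl.symm) ▸ hl⟩

end Literature.Topology.PlaneTopology
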